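import Mathlib
import HarnessLib

/-!
# A lacunary binary series and its dyadic approximants (solo-Schanuel-blind, session 6)

Module K1 of the kernel form of Proposition NG″
(`run/shared/lean/ideation/Schanuel/solo-blind/paper/nogo.md` §6; assembled in
`SoloBlindProfileNoGoConstruction.lean`). For a sequence `a : ℕ → ℕ` with `a 0 = 2`,
`a (k+1) = a k ^ 2` (so `a k = 2^(2^k)`; only `a 0 = 2` and strict monotonicity are used by most
lemmas) put

  `x = ∑_k 2^{-a_k}`,  `q_k = 2^{a_k}`,  `p_k = ∑_{j ≤ k} 2^{a_k - a_j}`.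

This file proves, without introducing definitions (the three objects are written out in each
statement):

* `linear_form_pos`, `linear_form_le`, `log_linear_form_le`: `0 < q_k x - p_k ≤ 2·2^{a_k}·2^{-a_{k+1}}`,
  i.e. `log (q_k x - p_k) ≤ (1 + a_k - a_{k+1}) log 2` (lacunary tail bound);
* `abs_numerator_add_abs_denominator_le`: `|p_k| + |q_k| ≤ 2^{a_k + 1}`;
* `numerators_cross_ne`: `p_k q_{k+1} ≠ p_{k+1} q_k` (consecutive approximants are distinct, so by
  `linear_pow_no_common_root` of `SoloBlindApproximantPowers.lean` their powers share no zero);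
* `exists_scale`: for `R ≥ 16` there is an index `i` with `a_{i+1} ≤ R < a_{i+2}` (and `a_i ≥ 4`).
-/

namespace Summit.Schanuel.Schanuel.Theorems

open Finset

section K1

variable {a : ℕ → ℕ}

/-- A sequence with `a (k+1) = a k ^ 2` and `a 0 = 2` takes values `≥ 2`. -/
theorem two_le_of_sq_seq (h0 : a 0 = 2) (hsq : ∀ k, a (k + 1) = a k ^ 2) (k : ℕ) : 2 ≤ a k := by
  induction k with
  | zero => simp [h0]
  | succ k ih => rw [hsq]; nlinarith

/-- … and is strictly increasing. -/
theorem strictMono_of_sq_seq (h0 : a 0 = 2) (hsq : ∀ k, a (k + 1) = a k ^ 2) : StrictMono a := by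
  refine strictMono_nat_of_lt_succ fun k => ?_
  have hk := two_le_of_sq_seq h0 hsq k
  rw [hsq]; nlinarith

/-- A strictly increasing `ℕ → ℕ` sequence gains at least `1` per step: `a k + i ≤ a (i + k)`. -/
theorem add_le_of_strictMono (ha : StrictMono a) (k i : ℕ) : a k + i ≤ a (i + k) := by
  induction i with
  | zero => simp
  | succ i ih =>
    have := ha (Nat.lt_succ_self (i + k))
    rw [Nat.succ_add]; omega

/-- `Σ_k 2^{-a_k}` converges for strictly increasing `a`. -/
theorem summable_half_pow (ha : StrictMono a) : Summable fun k => ((1:ℝ) / 2) ^ a k := by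
  refine Summable.of_nonneg_of_le (fun k => by positivity) (fun k => ?_) summable_geometric_two
  exact pow_le_pow_of_le_one (by norm_num) (by norm_num) (ha.id_le k)

/-- Tail after the `(k+1)`-st partial sum: positive … -/
theorem tail_pos (ha : StrictMono a) (k : ℕ) :
    0 < ∑' i, ((1:ℝ) / 2) ^ a (i + (k + 1)) := by
  have hs : Summable fun i => ((1:ℝ) / 2) ^ a (i + (k + 1)) :=
    (summable_half_pow ha).comp_injective (fun i j h => by simpa using h)
  exact hs.tsum_pos (fun i => by positivity) 0 (by positivity)

/-- … and at most `2 · 2^{-a(k+1)}`. -/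
theorem tail_le (ha : StrictMono a) (k : ℕ) :
    ∑' i, ((1:ℝ) / 2) ^ a (i + (k + 1)) ≤ 2 * ((1:ℝ) / 2) ^ a (k + 1) := by
  have hs : Summable fun i => ((1:ℝ) / 2) ^ a (i + (k + 1)) :=
    (summable_half_pow ha).comp_injective (fun i j h => by simpa using h)
  have hg : Summable fun i : ℕ => ((1:ℝ) / 2) ^ a (k + 1) * ((1:ℝ) / 2) ^ i :=
    summable_geometric_two.mul_left _
  calc ∑' i, ((1:ℝ) / 2) ^ a (i + (k + 1))
      ≤ ∑' i : ℕ, ((1:ℝ) / 2) ^ a (k + 1) * ((1:ℝ) / 2) ^ i := by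
        refine Summable.tsum_le_tsum (fun i => ?_) hs hg
        rw [← pow_add]
        exact pow_le_pow_of_le_one (by norm_num) (by norm_num) (add_le_of_strictMono ha (k + 1) i)
    _ = ((1:ℝ) / 2) ^ a (k + 1) * 2 := by rw [tsum_mul_left, tsum_geometric_two]
    _ = 2 * ((1:ℝ) / 2) ^ a (k + 1) := by ring

/-- Partial sums are `< 1` (indeed `≤ 1/2`) when `a 0 = 2`. -/
theorem partial_sum_lt_one (h0 : a 0 = 2) (ha : StrictMono a) (k : ℕ) :
    ∑ j ∈ range (k + 1), ((1:ℝ) / 2) ^ a j < 1 := by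
  have h1 : ∀ j, ((1:ℝ) / 2) ^ a j ≤ (1 / 4) * ((1:ℝ) / 2) ^ j := by
    intro j
    have : j + 2 ≤ a j := by have := add_le_of_strictMono ha 0 j; rw [h0, Nat.add_zero] at this; omega
    calc ((1:ℝ) / 2) ^ a j ≤ ((1:ℝ) / 2) ^ (j + 2) :=
          pow_le_pow_of_le_one (by norm_num) (by norm_num) this
      _ = (1 / 4) * ((1:ℝ) / 2) ^ j := by rw [pow_add]; ring
  calc ∑ j ∈ range (k + 1), ((1:ℝ) / 2) ^ a j
      ≤ ∑ j ∈ range (k + 1), (1 / 4) * ((1:ℝ) / 2) ^ j := sum_le_sum fun j _ => h1 j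
    _ = (1 / 4) * ∑ j ∈ range (k + 1), ((1:ℝ) / 2) ^ j := by rw [mul_sum]
    _ ≤ (1 / 4) * 2 := by gcongr; exact sum_geometric_two_le _
    _ < 1 := by norm_num

/-- The `k`-th approximant numerator `p_k = Σ_{j ≤ k} 2^{a_k - a_j}` satisfies
`p_k = 2^{a_k} · Σ_{j ≤ k} 2^{-a_j}` in `ℝ`. -/
theorem cast_numerator (ha : StrictMono a) (k : ℕ) :
    ((∑ j ∈ range (k + 1), (2:ℤ) ^ (a k - a j) : ℤ) : ℝ)
      = (2:ℝ) ^ a k * ∑ j ∈ range (k + 1), ((1:ℝ) / 2) ^ a j := by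
  push_cast
  rw [mul_sum]
  refine sum_congr rfl fun j hj => ?_
  have hjk : a j ≤ a k := ha.monotone (by simpa [Nat.lt_succ_iff] using hj)
  rw [one_div_pow, mul_one_div, eq_div_iff (by positivity), pow_sub_mul_pow _ hjk]

/-- K1, main: with `x = Σ_k 2^{-a_k}`, `q_k = 2^{a_k}`, `p_k = Σ_{j≤k} 2^{a_k-a_j}`:
`q_k x - p_k = 2^{a_k} · (tail)`. -/
theorem linear_form_eq_tail (ha : StrictMono a) (k : ℕ) :
    ((2:ℤ) ^ a k : ℤ) * (∑' j, ((1:ℝ) / 2) ^ a j) - ((∑ j ∈ range (k + 1), (2:ℤ) ^ (a k - a j) : ℤ) : ℝ)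
      = (2:ℝ) ^ a k * ∑' i, ((1:ℝ) / 2) ^ a (i + (k + 1)) := by
  rw [cast_numerator ha k, ← (summable_half_pow ha).sum_add_tsum_nat_add (k + 1)]
  push_cast
  ring

/-- The linear form `q_k x - p_k` is positive … -/
theorem linear_form_pos (ha : StrictMono a) (k : ℕ) :
    0 < ((2:ℤ) ^ a k : ℤ) * (∑' j, ((1:ℝ) / 2) ^ a j)
          - ((∑ j ∈ range (k + 1), (2:ℤ) ^ (a k - a j) : ℤ) : ℝ) := by
  rw [linear_form_eq_tail ha k]
  exact mul_pos (by positivity) (tail_pos ha k)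

/-- … and at most `2 · 2^{a_k} · 2^{-a_{k+1}}`. -/
theorem linear_form_le (ha : StrictMono a) (k : ℕ) :
    ((2:ℤ) ^ a k : ℤ) * (∑' j, ((1:ℝ) / 2) ^ a j)
          - ((∑ j ∈ range (k + 1), (2:ℤ) ^ (a k - a j) : ℤ) : ℝ)
      ≤ 2 * (2:ℝ) ^ a k * ((1:ℝ) / 2) ^ a (k + 1) := by
  rw [linear_form_eq_tail ha k]
  have := tail_le ha k
  have h2 : (0:ℝ) ≤ (2:ℝ) ^ a k := by positivity
  nlinarith

/-- `0 ≤ p_k < q_k`, hence `|p_k| + |q_k| ≤ 2^{a_k + 1}`. -/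
theorem abs_numerator_add_abs_denominator_le (h0 : a 0 = 2) (ha : StrictMono a) (k : ℕ) :
    |(∑ j ∈ range (k + 1), (2:ℤ) ^ (a k - a j) : ℤ)| + |((2:ℤ) ^ a k : ℤ)| ≤ 2 ^ (a k + 1) := by
  have hp0 : 0 ≤ (∑ j ∈ range (k + 1), (2:ℤ) ^ (a k - a j) : ℤ) := sum_nonneg fun j _ => by positivity
  have hq0 : 0 ≤ ((2:ℤ) ^ a k : ℤ) := by positivity
  rw [abs_of_nonneg hp0, abs_of_nonneg hq0, pow_succ]
  have hlt : ((∑ j ∈ range (k + 1), (2:ℤ) ^ (a k - a j) : ℤ) : ℝ) < ((2:ℤ) ^ a k : ℤ) := by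
    rw [cast_numerator ha k]
    push_cast
    have := partial_sum_lt_one h0 ha k
    have h2 : (0:ℝ) < (2:ℝ) ^ a k := by positivity
    nlinarith
  have hlt' : (∑ j ∈ range (k + 1), (2:ℤ) ^ (a k - a j) : ℤ) < (2:ℤ) ^ a k := by exact_mod_cast hlt
  linarith

/-- Consecutive approximants are distinct: `p_k q_{k+1} ≠ p_{k+1} q_k`. -/
theorem numerators_cross_ne (ha : StrictMono a) (k : ℕ) :
    (∑ j ∈ range (k + 1), (2:ℤ) ^ (a k - a j)) * (2:ℤ) ^ a (k + 1)
      ≠ (∑ j ∈ range (k + 1 + 1), (2:ℤ) ^ (a (k + 1) - a j)) * (2:ℤ) ^ a k := by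
  intro h
  have h' : (((∑ j ∈ range (k + 1), (2:ℤ) ^ (a k - a j)) * (2:ℤ) ^ a (k + 1) : ℤ) : ℝ)
      = (((∑ j ∈ range (k + 1 + 1), (2:ℤ) ^ (a (k + 1) - a j)) * (2:ℤ) ^ a k : ℤ) : ℝ) := by
    exact_mod_cast h
  rw [Int.cast_mul, Int.cast_mul, cast_numerator ha k,
    cast_numerator ha (k + 1), sum_range_succ _ (k + 1)] at h'
  push_cast at h'
  have h2k : (0:ℝ) < (2:ℝ) ^ a k := by positivity
  have h2k1 : (0:ℝ) < (2:ℝ) ^ a (k + 1) := by positivity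
  have hh : (0:ℝ) < ((1:ℝ) / 2) ^ a (k + 1) := by positivity
  nlinarith [mul_pos (mul_pos h2k h2k1) hh]

end K1

section Scale

variable {a : ℕ → ℕ}

/-- Logarithmic form of the tail bound: `log (q_k x - p_k) ≤ (1 + a_k - a_{k+1}) log 2`. -/
theorem log_linear_form_le (ha : StrictMono a) (k : ℕ) :
    Real.log (((2:ℤ) ^ a k : ℤ) * (∑' j, ((1:ℝ) / 2) ^ a j)
          - ((∑ j ∈ range (k + 1), (2:ℤ) ^ (a k - a j) : ℤ) : ℝ))
      ≤ (1 + (a k : ℝ) - (a (k + 1) : ℝ)) * Real.log 2 := by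
  have h := Real.log_le_log (linear_form_pos ha k) (linear_form_le ha k)
  refine h.trans (le_of_eq ?_)
  have : (2:ℝ) * 2 ^ a k * ((1:ℝ) / 2) ^ a (k + 1) = 2 ^ (a k + 1) / 2 ^ a (k + 1) := by
    rw [one_div_pow, pow_succ]; ring
  rw [this, Real.log_div (by positivity) (by positivity), Real.log_pow, Real.log_pow]
  push_cast
  ring

/-- Scale selection: for `R ≥ 16` there is an index `i` with `a_{i+1} ≤ R < a_{i+2}` (and then
`a_i ≥ 4`). -/
theorem exists_scale (h0 : a 0 = 2) (hsq : ∀ k, a (k + 1) = a k ^ 2) {R : ℝ} (hR : 16 ≤ R) :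
    ∃ i, 4 ≤ a i ∧ (a (i + 1) : ℝ) ≤ R ∧ R < (a (i + 1 + 1) : ℝ) := by
  classical
  have ha := strictMono_of_sq_seq h0 hsq
  have hex : ∃ n, R < (a (n + 1 + 1) : ℝ) := by
    refine ⟨⌈R⌉₊, ?_⟩
    have h1 : ((⌈R⌉₊ + 1 + 1 : ℕ) : ℝ) ≤ (a (⌈R⌉₊ + 1 + 1) : ℝ) := by
      exact_mod_cast ha.id_le (⌈R⌉₊ + 1 + 1)
    have h2 := Nat.le_ceil R
    push_cast at h1
    linarith
  have a1 : a 1 = 4 := by have := hsq 0; rw [h0] at this; simpa using this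
  have a2 : a 2 = 16 := by have := hsq 1; rw [a1] at this; simpa using this
  refine ⟨Nat.find hex, ?_, ?_, Nat.find_spec hex⟩
  · have hi0 : Nat.find hex ≠ 0 := by
      intro h
      have := Nat.find_spec hex
      rw [h] at this
      norm_num [a2] at this
      linarith
    calc 4 = a 1 := a1.symm
      _ ≤ a (Nat.find hex) := ha.monotone (Nat.one_le_iff_ne_zero.mpr hi0)
  · have hi0 : Nat.find hex ≠ 0 := by
      intro h
      have := Nat.find_spec hex
      rw [h] at this
      norm_num [a2] at this
      linarith
    obtain ⟨m, hm⟩ := Nat.exists_eq_succ_of_ne_zero hi0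
    have hmin : ¬ (R < (a (m + 1 + 1) : ℝ)) := Nat.find_min hex (by omega)
    rw [hm]
    exact not_lt.mp hmin

end Scale

#harness_tags linear_form_le

end Summit.Schanuel.Schanuel.Theorems
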